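import Summits.FinalStateConjecture.FinalStateConjecture.Theorems.KerrShieldedDataExist.Negative.BentSliceConormal
import Summits.FinalStateConjecture.FinalStateConjecture.Theorems.SwallowTheDatumKerrShieldedDataExistBridgeRadial
import Summits.FinalStateConjecture.FinalStateConjecture.Theorems.SwallowTheDatumKerrShieldedDataExistBridgeImmersion
import Summits.FinalStateConjecture.FinalStateConjecture.Theorems.SwallowTheDatumKerrShieldedDataExistBridgeSecondForm
import Summits.FinalStateConjecture.FinalStateConjecture.Theorems.SwallowTheDatumKerrShieldedDataExistBridgeProfileAssembly
import Summits.FinalStateConjecture.FinalStateConjecture.Theorems.SwallowTheDatumKerrShieldedDataExistBridgeProfileExists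
import Literature.Geometry.Lorentzian.ModelData
import Literature.Geometry.Lorentzian.LeviCivitaProofs
import Mathlib.Analysis.SpecialFunctions.Log.Deriv
import HarnessLib

/-!
# `KerrShieldedDataExist`, line `plug-the-second-sheet` — stub `stub_bridgeAnnulus`

Stub 5a of the lead's skeleton for crux `stmt-FinalStateConjecture-10055` (the BRIDGE annulus): for `M > 0`,
on `Ω = {M/40 < |y| < 3M/4} ⊂ E3` there is a VACUUM initial data set which near the inner rim (`|y| < M/30`)
is exactly sheet-two isotropic Schwarzschild `((1 + M/2s)⁴ δ, 0)` and near the outer rim (`|y| > 7M/10`) is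
exactly the Kerr–Schild slice data `(Kerr.hRep M, Kerr.kRep M)`.

Construction (`stub_bridgeAnnulus`): the datum induced — hypothesis `hInd` (= landed `stub_inducedVacuumData`),
fed with the Ricci-flatness `hRic` (= landed `stub_ricciFlatKS`) — by ONE spherically symmetric spacelike
immersion `y ↦ (τ(|y|), (ϱ(|y|)/|y|) y)` of `Ω` into the ingoing Schwarzschild chart `(Kerr.region 0 0, g_{M,0})`,
read as the LEFT ingoing chart of the Kruskal plane (both ingoing charts carry the same Kerr–Schild form and the
same time orientation on the black-hole region, O'Neill 1983, Ch. 13), with the profile of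
`exists_bridgeProfile` (`…BridgeProfileExists`): immersion/normal/smoothness by `…BridgeImmersion`; inner rim
`h = (1 + M/2s)⁴ δ`, `K = 0` and outer rim `h = hRep`, `K = kRep` by `…BridgeSecondForm` and the rim
derivatives `rim_inner_deriv`, `rim_outer_deriv` below.

References: O'Neill 1983, Ch. 4 and Ch. 13; Cook 2000, §3.2.2; Wald 1984, §6.4; Dafermos–Rodnianski
arXiv:0811.0354, §5.1.
-/

-- the doubled `FinalStateConjecture` path component is the summit/problem naming scheme, not a mistake
set_option linter.dupNamespace false

noncomputable section

open Real Set Filter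
open scoped Manifold ContDiff Topology InnerProductSpace
open Literature.Geometry.Lorentzian
open Summit.FinalStateConjecture.FinalStateConjecture.Theorems.KerrShieldedDataExist

namespace Summit.FinalStateConjecture.FinalStateConjecture.Theorems.SwallowTheDatum

namespace Bridge

/-! ### Derivatives of the profile at the two rims -/

section RimDerivatives

variable {M c : ℝ} {τ ϱ : ℝ → ℝ}

/-- **Inner rim.** Where `ϱ = ρI` and `τ = T ∘ ρI + c` (on the open set `0 < s < 3M/10`) and `ρI(s) ≥ 8M`
(`s < M/28`), the derivatives are `ϱ′ = (2s − M)(2s + M)/(4s²)` and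
`τ′ = T′(ρI) ρI′ = 2M(2s + M)/(s(2s − M))` (`T′ = 2M/(r − 2M)` on `r ≥ 8M`, the Boyer–Lindquist slope), and the
static relation `−τ′ + (2M/ϱ)(ϱ′ + τ′) = 0` holds. [cite: arXiv08110354, §5.1] -/
theorem rim_inner_deriv (hM : 0 < M)
    (hin : ∀ s ∈ Ioo 0 (3 * M / 10), ϱ s = (2 * s + M) ^ 2 / (4 * s) ∧
      τ s = Negative.bentHeight M 0 ((2 * s + M) ^ 2 / (4 * s)) + c)
    {s : ℝ} (hs0 : 0 < s) (hs1 : s < M / 28) :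
    deriv ϱ s = (2 * s - M) * (2 * s + M) / (4 * s ^ 2) ∧
      deriv τ s = 2 * M * (2 * s + M) / (s * (2 * s - M)) ∧
      -deriv τ s + 2 * M / ϱ s * (deriv ϱ s + deriv τ s) = 0 := by
  have h0M : |(0 : ℝ)| < M := by rwa [abs_zero]
  have hs3 : s < 3 * M / 10 := by linarith
  have hsM : 2 * s - M ≠ 0 := by intro h; linarith
  have hsM' : s * 2 - M ≠ 0 := by rwa [mul_comm] at hsM
  have hpM : 2 * s + M ≠ 0 := by intro h; linarith
  have hpM' : s * 2 + M ≠ 0 := by rwa [mul_comm] at hpM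
  have hs : s ≠ 0 := hs0.ne'
  set r := (2 * s + M) ^ 2 / (4 * s) with hr
  have hr8 : 8 * M ≤ r := by
    rw [hr, le_div_iff₀ (by positivity)]; nlinarith
  have hr0 : 0 < r := by linarith
  have hr2 : r - 2 * M = (2 * s - M) ^ 2 / (4 * s) := by rw [hr]; field_simp; ring
  have hev : ∀ᶠ t in 𝓝 s, t ∈ Ioo 0 (3 * M / 10) := isOpen_Ioo.mem_nhds ⟨hs0, hs3⟩
  have hϱ : HasDerivAt ϱ ((2 * s - M) * (2 * s + M) / (4 * s ^ 2)) s :=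
    (hasDerivAt_rhoIso hs).congr_of_eventuallyEq (hev.mono fun t ht ↦ (hin t ht).1)
  have hslope : Negative.bentSlope M 0 r = 2 * M * r / (r * (r - 2 * M)) := by
    rw [Negative.bentSlope_eq_of_ge hM hr8]; ring_nf
  have hτ : HasDerivAt τ (Negative.bentSlope M 0 r * ((2 * s - M) * (2 * s + M) / (4 * s ^ 2))) s := by
    have h := ((Negative.hasDerivAt_bentHeight h0M r).comp s (hasDerivAt_rhoIso hs)).add_const c
    refine h.congr_of_eventuallyEq (hev.mono fun t ht ↦ ?_)
    rw [(hin t ht).2]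
    rfl
  have ht₁ : Negative.bentSlope M 0 r * ((2 * s - M) * (2 * s + M) / (4 * s ^ 2)) =
      2 * M * (2 * s + M) / (s * (2 * s - M)) := by
    rw [hslope, hr2]
    field_simp
  rw [hϱ.deriv, hτ.deriv, ht₁, (hin s ⟨hs0, hs3⟩).1]
  refine ⟨rfl, rfl, ?_⟩
  field_simp
  ring

/-- **Outer rim.** Where `ϱ = id` and `τ = 4M log(1 − s/2M)` (on the open set `7M/10 < s < M`), the
derivatives are `ϱ′ = 1`, `τ′ = −4M/(2M − s)`, and `τ′` has derivative `−4M/(2M − s)²` there. [folklore] -/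
theorem rim_outer_deriv (hM : 0 < M)
    (hout : ∀ s ∈ Ioo (7 * M / 10) M, ϱ s = s ∧ τ s = 4 * M * Real.log (1 - s / (2 * M)))
    {s : ℝ} (hs : s ∈ Ioo (7 * M / 10) M) :
    deriv ϱ s = 1 ∧ deriv τ s = -(4 * M) / (2 * M - s) ∧
      HasDerivAt (deriv τ) (-(4 * M) / (2 * M - s) ^ 2) s := by
  have hev : ∀ᶠ t in 𝓝 s, t ∈ Ioo (7 * M / 10) M := isOpen_Ioo.mem_nhds hs
  have hϱ : HasDerivAt ϱ 1 s := (hasDerivAt_id' s).congr_of_eventuallyEq (hev.mono fun t ht ↦ (hout t ht).1)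
  have hG : ∀ t ∈ Ioo (7 * M / 10) M, HasDerivAt (fun t : ℝ ↦ 4 * M * Real.log (1 - t / (2 * M)))
      (-(4 * M) / (2 * M - t)) t := by
    intro t ht
    have h2 : 0 < 1 - t / (2 * M) := by
      rw [sub_pos, div_lt_one (by positivity)]; linarith [ht.2]
    have h1 : HasDerivAt (fun t : ℝ ↦ 1 - t / (2 * M)) (-(1 / (2 * M))) t := by
      simpa using ((hasDerivAt_id' t).div_const (2 * M)).const_sub 1
    have h := (h1.log h2.ne').const_mul (4 * M)
    have hM2 : M * 2 - t ≠ 0 := by linarith [ht.2]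
    have e : 4 * M * (-(1 / (2 * M)) / (1 - t / (2 * M))) = -(4 * M) / (2 * M - t) := by
      field_simp
    rw [e] at h
    exact h
  have hτ : ∀ t ∈ Ioo (7 * M / 10) M, HasDerivAt τ (-(4 * M) / (2 * M - t)) t := fun t ht ↦ by
    have hevt : ∀ᶠ u in 𝓝 t, u ∈ Ioo (7 * M / 10) M := isOpen_Ioo.mem_nhds ht
    exact (hG t ht).congr_of_eventuallyEq (hevt.mono fun u hu ↦ (hout u hu).2)
  have hdτ : deriv τ =ᶠ[𝓝 s] fun t ↦ -(4 * M) / (2 * M - t) := hev.mono fun t ht ↦ (hτ t ht).deriv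
  have hG' : HasDerivAt (fun t : ℝ ↦ -(4 * M) / (2 * M - t)) (-(4 * M) / (2 * M - s) ^ 2) s := by
    have h2 : 2 * M - s ≠ 0 := by linarith [hs.2]
    have h := (hasDerivAt_const s (-(4 * M))).fun_div ((hasDerivAt_id' s).const_sub (2 * M)) h2
    refine h.congr_deriv ?_
    field_simp
    ring
  exact ⟨hϱ.deriv, (hτ s hs).deriv, hG'.congr_of_eventuallyEq hdτ⟩

end RimDerivatives

end Bridge

/-! ### The stub -/

open Bridge in
/-- **Stub `stub_bridgeAnnulus` of line `plug-the-second-sheet` (crux `stmt-FinalStateConjecture-10055`): the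
BRIDGE annulus.** For `M > 0`, on `Ω = {M/40 < |y| < 3M/4} ⊂ E3` there is a vacuum initial data set which
near the inner rim (`|y| < M/30`) is EXACTLY sheet-two isotropic Schwarzschild `((1 + M/2s)⁴δ, 0)` and near the
outer rim (`|y| > 7M/10`) is EXACTLY the Kerr–Schild slice data `(Kerr.hRep M, Kerr.kRep M)`. It is the datum
induced (hypothesis `hInd`, fed with the Ricci-flatness `hRic` of the chart) by ONE spherically symmetric
spacelike immersion `y ↦ (τ(|y|), (ϱ(|y|)/|y|) y)` of `Ω` into the ingoing Schwarzschild chart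
`(Kerr.region 0 0, g_{M,0})` (read as the LEFT chart of the Kruskal plane), with the profile of
`exists_bridgeProfile`: the Boyer–Lindquist leaf `t* = c + T(r)` of the left exterior read through the
isotropic map (inner rim: `h = (1 + M/2s)⁴δ` by `bilin_tangent_tangent_eq_iso`, `K = 0` by
`secondFundamentalForm_eq_zero_of_static`), the left Kerr–Schild slice through the left horizon, a rounded
spacelike corner in the black-hole region, and the graph `t*_L = 4M log(1 − r/2M)` = the slice `{t*_R = 0}` of
the right chart (outer rim: `h = hRep` by `bilin_tangent_tangent_eq_hRep`, `K = kRep` by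
`secondFundamentalForm_eq_kRep`; O'Neill 1983, Ch. 13). [cite: ONeill1983, Ch. 13] [cite: Cook2000, §3.2.2] -/
theorem stub_bridgeAnnulus :
    ∀ [Kerr.Facts] (M : ℝ), 0 < M →
      -- Ricci-flatness of every Kerr–Schild Schwarzschild chart (statement of `stub_ricciFlatKS`)
      (∀ (r₀ : ℝ) [(Kerr.smoothMetric M 0 r₀).HasLeviCivita] (x : Kerr.region 0 r₀),
        (Kerr.smoothMetric M 0 r₀).ricci x = 0) →
      -- induced vacuum data of spacelike immersions (statement of `stub_inducedVacuumData` at this `M`)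
      (∀ (r₀ : ℝ) (U : TopologicalSpace.Opens E3) (Φ N : E3 → E4)
        (f : U → Kerr.region 0 r₀) (ν : NormalField 𝓘(ℝ, E4) f),
        (∀ [(Kerr.smoothMetric M 0 r₀).HasLeviCivita] (x : Kerr.region 0 r₀), (Kerr.smoothMetric M 0 r₀).ricci x = 0) →
        (∀ y : U, ((f y : Kerr.region 0 r₀) : E4) = Φ y) → (∀ y : U, ν y = N y) →
        ContDiffOn ℝ ∞ Φ (U : Set E3) → ContDiffOn ℝ ∞ N (U : Set E3) →
        (Kerr.smoothMetric M 0 r₀).IsSpacelikeImmersion 𝓘(ℝ, E3) f →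
        (Kerr.smoothMetric M 0 r₀).IsUnitNormal 𝓘(ℝ, E3) f ν (-1) →
        ∃ D : InitialDataSet 𝓘(ℝ, E3) U,
          (∀ y : U, D.h.inner y = (Kerr.smoothMetric M 0 r₀).inducedBilin 𝓘(ℝ, E3) f y) ∧
          (∀ [(Kerr.smoothMetric M 0 r₀).HasLeviCivita] (y : U),
            (D.k y).toLinearMap₁₂ = (Kerr.smoothMetric M 0 r₀).secondFundamentalForm 𝓘(ℝ, E3) f ν y) ∧
          (∀ [D.metric.HasLeviCivita], D.IsVacuumConstraintSolution)) →
      ContDiff ℝ ∞ (Negative.bentHeight M 0) →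
      ∀ (Ω : TopologicalSpace.Opens E3), (Ω : Set E3) = {y : E3 | M / 40 < ‖y‖ ∧ ‖y‖ < 3 * M / 4} →
        ∃ Db : InitialDataSet 𝓘(ℝ, E3) Ω,
          (∀ [Db.metric.HasLeviCivita], Db.IsVacuumConstraintSolution) ∧
          (∀ y : Ω, ‖(y : E3)‖ < M / 30 →
            (∀ v w : E3, Db.h.inner y v w = Schwarzschild.conformalFactor M (y : E3) ^ 4 * ⟪v, w⟫_ℝ) ∧
              Db.k y = 0) ∧
          (∀ y : Ω, 7 * M / 10 < ‖(y : E3)‖ →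
            (∀ v w : E3, Db.h.inner y v w = Kerr.hRep M (y : E3) v w) ∧
              (∀ v w : E3, Db.k y v w = Kerr.kRep M (y : E3) v w)) := by
  intro _ M hM hRic hInd hT Ω hΩ
  obtain ⟨τ, ϱ, c, hϱs, hτs, hA, hin, hout⟩ := exists_bridgeProfile hM hT
  -- the radii of `Ω` and the derivative functions
  set S : Set ℝ := Ioo (M / 40) (3 * M / 4) with hS
  have hSo : IsOpen S := isOpen_Ioo
  have hS0 : S ⊆ Ioi 0 := fun s hs ↦ lt_trans (by positivity) hs.1
  have hmem : ∀ y : E3, y ∈ Ω ↔ M / 40 < ‖y‖ ∧ ‖y‖ < 3 * M / 4 := fun y ↦ by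
    rw [← SetLike.mem_coe, hΩ]; rfl
  have hU0 : ∀ y ∈ Ω, y ≠ 0 := fun y hy ↦ by
    have := ((hmem y).1 hy).1
    exact norm_pos_iff.1 (lt_trans (by positivity) this)
  have hUS : ∀ y ∈ Ω, ‖y‖ ∈ S := fun y hy ↦ (hmem y).1 hy
  have hτS : ContDiffOn ℝ ∞ τ S := hτs.mono hS0
  have hϱS : ContDiffOn ℝ ∞ ϱ S := hϱs.mono hS0
  set τ' := deriv τ with hτ'
  set ϱ' := deriv ϱ with hϱ'
  have hτ'S : ContDiffOn ℝ ∞ τ' S := ((contDiffOn_infty_iff_deriv_of_isOpen hSo).1 hτS).2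
  have hϱ'S : ContDiffOn ℝ ∞ ϱ' S := ((contDiffOn_infty_iff_deriv_of_isOpen hSo).1 hϱS).2
  have hdτ : ∀ s ∈ S, HasDerivAt τ (τ' s) s := fun s hs ↦
    ((hτS.differentiableOn (by simp)).differentiableAt (hSo.mem_nhds hs)).hasDerivAt
  have hdϱ : ∀ s ∈ S, HasDerivAt ϱ (ϱ' s) s := fun s hs ↦
    ((hϱS.differentiableOn (by simp)).differentiableAt (hSo.mem_nhds hs)).hasDerivAt
  have hpos : ∀ s ∈ S, 0 < ϱ s := fun s hs ↦ (hA s hs).1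
  have hAS : ∀ s ∈ S, 0 < -τ' s ^ 2 + ϱ' s ^ 2 + 2 * M / ϱ s * (τ' s + ϱ' s) ^ 2 := fun s hs ↦ (hA s hs).2
  -- the immersion and its normal
  set Φ : E3 → E4 := fun y ↦ τ ‖y‖ • E4.basisVector 0 + (ϱ ‖y‖ / ‖y‖) • E4.spaceEmbed y with hΦdef
  have hΦ : ∀ y, Φ y = τ ‖y‖ • E4.basisVector 0 + (ϱ ‖y‖ / ‖y‖) • E4.spaceEmbed y := fun y ↦ rfl
  set N : E3 → E4 := fun y ↦ (√(-τ' ‖y‖ ^ 2 + ϱ' ‖y‖ ^ 2 + 2 * M / ϱ ‖y‖ * (τ' ‖y‖ + ϱ' ‖y‖) ^ 2))⁻¹ •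
      ((-ϱ' ‖y‖ - 2 * M / ϱ ‖y‖ * (ϱ' ‖y‖ + τ' ‖y‖)) • E4.basisVector 0 +
        ((-τ' ‖y‖ + 2 * M / ϱ ‖y‖ * (ϱ' ‖y‖ + τ' ‖y‖)) / ‖y‖) • E4.spaceEmbed y) with hNdef
  have hN : ∀ y, N y = (√(-τ' ‖y‖ ^ 2 + ϱ' ‖y‖ ^ 2 + 2 * M / ϱ ‖y‖ * (τ' ‖y‖ + ϱ' ‖y‖) ^ 2))⁻¹ •
      ((-ϱ' ‖y‖ - 2 * M / ϱ ‖y‖ * (ϱ' ‖y‖ + τ' ‖y‖)) • E4.basisVector 0 +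
        ((-τ' ‖y‖ + 2 * M / ϱ ‖y‖ * (ϱ' ‖y‖ + τ' ‖y‖)) / ‖y‖) • E4.spaceEmbed y) := fun y ↦ rfl
  have hmemR : ∀ y : Ω, Φ y ∈ Kerr.region 0 0 := fun y ↦
    radialMap_mem_region hΦ (hU0 y y.2) (by rw [max_self]; exact hpos _ (hUS y y.2))
  set F : Ω → Kerr.region 0 0 := fun y ↦ ⟨Φ y, hmemR y⟩ with hFdef
  have hF : ∀ y : Ω, (F y : E4) = Φ y := fun y ↦ rfl
  have hsp := isSpacelikeImmersion_of_radialMap (M := M) (r₀ := 0) hSo hτS hϱS hΦ hU0 hUS hF hdτ hdϱ hpos hAS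
  have hun := isUnitNormal_of_radialMap (M := M) (r₀ := 0) (N := N) hΦ hU0 hUS hF hdτ hdϱ hpos hAS hN
  have hΦc : ContDiffOn ℝ ∞ Φ (Ω : Set E3) := contDiffOn_radialMap hSo hτS hϱS hΦ hU0 hUS
  have hNc : ContDiffOn ℝ ∞ N (Ω : Set E3) := contDiffOn_radialNormal hSo hϱS hτ'S hϱ'S hU0 hUS hpos hAS hN
  obtain ⟨D, hDh, hDk, hDvac⟩ := hInd 0 Ω Φ N F (fun y ↦ N y) (hRic 0) hF (fun _ ↦ rfl) hΦc hNc hsp hun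
  haveI : (Kerr.smoothMetric M 0 0).HasLeviCivita :=
    PseudoRiemannianMetric.hasLeviCivita (Kerr.smoothMetric M 0 0).toPseudoRiemannianMetric
  have hNd : ∀ y : Ω, DifferentiableAt ℝ N y := fun y ↦
    (hNc.differentiableOn (by simp)).differentiableAt (Ω.isOpen.mem_nhds y.2)
  have hk : ∀ (y : Ω) (v w : E3), D.k y v w =
      (Kerr.smoothMetric M 0 0).secondFundamentalForm 𝓘(ℝ, E3) F (fun y ↦ N y) y v w := fun y v w ↦
    congrArg (fun B : LinearMap.BilinForm ℝ E3 ↦ B v w) (hDk y)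
  refine ⟨D, hDvac, fun y hy30 ↦ ?_, fun y hy70 ↦ ?_⟩
  · -- inner rim: the Boyer–Lindquist leaf through the isotropic map
    have hyΩ := (hmem y).1 y.2
    have hy0 : (y : E3) ≠ 0 := hU0 y y.2
    have hyS : ‖(y : E3)‖ ∈ S := hUS y y.2
    have hs0 : 0 < ‖(y : E3)‖ := norm_pos_iff.2 hy0
    have hs28 : ‖(y : E3)‖ < M / 28 := by linarith
    have hs3 : ‖(y : E3)‖ < 3 * M / 10 := by linarith
    obtain ⟨hϱ's, hτ's, hstatic⟩ := rim_inner_deriv hM hin hs0 hs28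
    have hϱs_eq : ϱ ‖(y : E3)‖ = (2 * ‖(y : E3)‖ + M) ^ 2 / (4 * ‖(y : E3)‖) := (hin _ ⟨hs0, hs3⟩).1
    have hx : E4.spatial (F y : E4) = (ϱ ‖(y : E3)‖ / ‖(y : E3)‖) • (y : E3) := spatial_radialMap hΦ y
    have e1 : ϱ' ‖(y : E3)‖ = (2 * ‖(y : E3)‖ - M) * (2 * ‖(y : E3)‖ + M) / (4 * ‖(y : E3)‖ ^ 2) := hϱ's
    have e2 : τ' ‖(y : E3)‖ = 2 * M * (2 * ‖(y : E3)‖ + M) / (‖(y : E3)‖ * (2 * ‖(y : E3)‖ - M)) := hτ's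
    constructor
    · intro v w
      have hgoal : Kerr.bilin M 0 (F y : E4)
          ((τ' ‖(y : E3)‖ * ‖(y : E3)‖⁻¹ * ⟪(y : E3), v⟫_ℝ) • E4.basisVector 0 +
            ((ϱ' ‖(y : E3)‖ * ‖(y : E3)‖ - ϱ ‖(y : E3)‖) / ‖(y : E3)‖ ^ 3 * ⟪(y : E3), v⟫_ℝ) •
              E4.spaceEmbed (y : E3) + (ϱ ‖(y : E3)‖ / ‖(y : E3)‖) • E4.spaceEmbed v)
          ((τ' ‖(y : E3)‖ * ‖(y : E3)‖⁻¹ * ⟪(y : E3), w⟫_ℝ) • E4.basisVector 0 +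
            ((ϱ' ‖(y : E3)‖ * ‖(y : E3)‖ - ϱ ‖(y : E3)‖) / ‖(y : E3)‖ ^ 3 * ⟪(y : E3), w⟫_ℝ) •
              E4.spaceEmbed (y : E3) + (ϱ ‖(y : E3)‖ / ‖(y : E3)‖) • E4.spaceEmbed w) =
          Schwarzschild.conformalFactor M (y : E3) ^ 4 * ⟪v, w⟫_ℝ := by
        rw [Schwarzschild.conformalFactor_apply]
        exact bilin_tangent_tangent_eq_iso M hy0 (by intro h; linarith) (hpos _ hyS) hx hϱs_eq e1 e2 v w
      rw [hDh y, PseudoRiemannianMetric.inducedBilin_apply, Kerr.smoothMetric_val,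
        mfderiv_of_radialMap_apply hΦ hF y hy0 (hdτ _ hyS) (hdϱ _ hyS),
        mfderiv_of_radialMap_apply hΦ hF y hy0 (hdτ _ hyS) (hdϱ _ hyS)]
      exact hgoal
    · refine ContinuousLinearMap.ext fun v ↦ ContinuousLinearMap.ext fun w ↦ ?_
      rw [hk y v w]
      refine secondFundamentalForm_eq_zero_of_static hF (fun _ ↦ rfl) hΦ hy0 (hdτ _ hyS) (hdϱ _ hyS)
        (hpos _ hyS) hstatic (lam := fun z ↦ N z 0) ?_ ?_ v w
      · have hev : ∀ᶠ z : E3 in 𝓝 (y : E3), ‖z‖ ∈ Ioo (M / 40) (M / 28) :=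
          continuous_norm.continuousAt.preimage_mem_nhds (isOpen_Ioo.mem_nhds ⟨hyΩ.1, hs28⟩)
        filter_upwards [hev] with z hz
        have hz0 : 0 < ‖z‖ := lt_trans (by positivity) hz.1
        obtain ⟨-, -, hstz⟩ := rim_inner_deriv hM hin hz0 hz.2
        have hn1 : -τ' ‖z‖ + 2 * M / ϱ ‖z‖ * (ϱ' ‖z‖ + τ' ‖z‖) = 0 := hstz
        have hNz : N z = ((√(-τ' ‖z‖ ^ 2 + ϱ' ‖z‖ ^ 2 + 2 * M / ϱ ‖z‖ * (τ' ‖z‖ + ϱ' ‖z‖) ^ 2))⁻¹ *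
            (-ϱ' ‖z‖ - 2 * M / ϱ ‖z‖ * (ϱ' ‖z‖ + τ' ‖z‖))) • E4.basisVector 0 := by
          rw [hN, hn1, zero_div, zero_smul, add_zero, smul_smul]
        rw [hNz]
        simp
      · exact (EuclideanSpace.proj (0 : Fin 4)).differentiableAt.comp (y : E3) (hNd y)
  · -- outer rim: the Kerr–Schild graph `t* = 4M log(1 − r/2M)`
    have hyΩ := (hmem y).1 y.2
    have hy0 : (y : E3) ≠ 0 := hU0 y y.2
    have hyS : ‖(y : E3)‖ ∈ S := hUS y y.2
    have hs7 : ‖(y : E3)‖ ∈ Ioo (7 * M / 10) M := ⟨hy70, by linarith [hyΩ.2]⟩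
    obtain ⟨hϱ's, hτ's, hτ''⟩ := rim_outer_deriv hM hout hs7
    have hϱs_eq : ϱ ‖(y : E3)‖ = ‖(y : E3)‖ := (hout _ hs7).1
    have e1 : ϱ' ‖(y : E3)‖ = 1 := hϱ's
    have e2 : τ' ‖(y : E3)‖ = -(4 * M) / (2 * M - ‖(y : E3)‖) := hτ's
    have hx : E4.spatial (F y : E4) = (‖(y : E3)‖ / ‖(y : E3)‖) • (y : E3) := by
      have hx0 := spatial_radialMap hΦ (y : E3)
      rw [hϱs_eq] at hx0
      exact hx0
    constructor
    · intro v w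
      have hgoal : Kerr.bilin M 0 (F y : E4)
          ((τ' ‖(y : E3)‖ * ‖(y : E3)‖⁻¹ * ⟪(y : E3), v⟫_ℝ) • E4.basisVector 0 +
            ((1 * ‖(y : E3)‖ - ‖(y : E3)‖) / ‖(y : E3)‖ ^ 3 * ⟪(y : E3), v⟫_ℝ) • E4.spaceEmbed (y : E3) +
              (‖(y : E3)‖ / ‖(y : E3)‖) • E4.spaceEmbed v)
          ((τ' ‖(y : E3)‖ * ‖(y : E3)‖⁻¹ * ⟪(y : E3), w⟫_ℝ) • E4.basisVector 0 +
            ((1 * ‖(y : E3)‖ - ‖(y : E3)‖) / ‖(y : E3)‖ ^ 3 * ⟪(y : E3), w⟫_ℝ) • E4.spaceEmbed (y : E3) +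
              (‖(y : E3)‖ / ‖(y : E3)‖) • E4.spaceEmbed w) = Kerr.hRep M (y : E3) v w :=
        bilin_tangent_tangent_eq_hRep M hy0 (by linarith [hs7.2]) hx e2 v w
      rw [hDh y, PseudoRiemannianMetric.inducedBilin_apply, Kerr.smoothMetric_val,
        mfderiv_of_radialMap_apply hΦ hF y hy0 (hdτ _ hyS) (hdϱ _ hyS),
        mfderiv_of_radialMap_apply hΦ hF y hy0 (hdτ _ hyS) (hdϱ _ hyS), e1, hϱs_eq]
      exact hgoal
    · intro v w
      rw [hk y v w]
      have hevS : ∀ᶠ t in 𝓝 ‖(y : E3)‖, t ∈ S := hSo.mem_nhds hyS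
      have hev7 : ∀ᶠ t in 𝓝 ‖(y : E3)‖, t ∈ Ioo (7 * M / 10) M := isOpen_Ioo.mem_nhds hs7
      exact secondFundamentalForm_eq_kRep hM hF (fun _ ↦ rfl) hΦ hN hy0 (by linarith [hs7.2])
        (hevS.mono fun t ht ↦ hdτ t ht) (hevS.mono fun t ht ↦ hdϱ t ht)
        (hev7.mono fun t ht ↦ (hout t ht).1) (hev7.mono fun t ht ↦ (rim_outer_deriv hM hout ht).1)
        (hev7.mono fun t ht ↦ (rim_outer_deriv hM hout ht).2.1) hτ'' (hNd y) v w


/-- `stub_bridgeAnnulus` once more, with its signature written without the interleaved comment lines (the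
registered one-line form of the sub-goal `stub_bridgeAnnulus_plain`; same statement, same proof). [cite: ONeill1983, Ch. 13] -/
theorem stub_bridgeAnnulus_plain :
    ∀ [Kerr.Facts] (M : ℝ), 0 < M → (∀ (r₀ : ℝ) [(Kerr.smoothMetric M 0 r₀).HasLeviCivita] (x : Kerr.region 0 r₀), (Kerr.smoothMetric M 0 r₀).ricci x = 0) → (∀ (r₀ : ℝ) (U : TopologicalSpace.Opens E3) (Φ N : E3 → E4) (f : U → Kerr.region 0 r₀) (ν : NormalField 𝓘(ℝ, E4) f), (∀ [(Kerr.smoothMetric M 0 r₀).HasLeviCivita] (x : Kerr.region 0 r₀), (Kerr.smoothMetric M 0 r₀).ricci x = 0) → (∀ y : U, ((f y : Kerr.region 0 r₀) : E4) = Φ y) → (∀ y : U, ν y = N y) → ContDiffOn ℝ ∞ Φ (U : Set E3) → ContDiffOn ℝ ∞ N (U : Set E3) → (Kerr.smoothMetric M 0 r₀).IsSpacelikeImmersion 𝓘(ℝ, E3) f → (Kerr.smoothMetric M 0 r₀).IsUnitNormal 𝓘(ℝ, E3) f ν (-1) → ∃ D : InitialDataSet 𝓘(ℝ, E3) U, (∀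 y : U, D.h.inner y = (Kerr.smoothMetric M 0 r₀).inducedBilin 𝓘(ℝ, E3) f y) ∧ (∀ [(Kerr.smoothMetric M 0 r₀).HasLeviCivita] (y : U), (D.k y).toLinearMap₁₂ = (Kerr.smoothMetric M 0 r₀).secondFundamentalForm 𝓘(ℝ, E3) f ν y) ∧ (∀ [D.metric.HasLeviCivita], D.IsVacuumConstraintSolution)) → ContDiff ℝ ∞ (Negative.bentHeight M 0) → ∀ (Ω : TopologicalSpace.Opens E3), (Ω : Set E3) = {y : E3 | M / 40 < ‖y‖ ∧ ‖y‖ < 3 * M / 4} → ∃ Db : InitialDataSet 𝓘(ℝ, E3) Ω, (∀ [Db.metric.HasLeviCivita], Db.IsVacuumConstraintSolution) ∧ (∀ y : Ω, ‖(y : E3)‖ < M / 30 → (∀ v w : E3, Db.h.inner y v w = Schwarzschild.conformalFactor M (y : E3) ^ 4 * ⟪v, w⟫_ℝ) ∧ Db.k y = 0) ∧ (∀ y : Ω, 7 * M / 10 < ‖(y : E3)‖ → (∀ v w : E3, Db.h.inner y v w = Kerr.hRep M (y : E3) v w) ∧ (∀ v w : E3, Db.k y v w = Kerr.kRep M (y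 : E3) v w)) :=
  @stub_bridgeAnnulus

end Summit.FinalStateConjecture.FinalStateConjecture.Theorems.SwallowTheDatum

end
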